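import Mathlib.Analysis.Complex.Liouville
import Mathlib.Analysis.Complex.RemovableSingularity
import Mathlib.Analysis.Calculus.DSlope
import Mathlib.Analysis.Normed.Field.Lemmas
import Mathlib.Topology.Homeomorph.Lemmas
import Literature.Analysis.Complex.InjectiveHolomorphic
import HarnessLib

/-!
# Injective entire functions which are proper are affine

An entire function `f : ℂ → ℂ` which is injective and proper (`f z → ∞` as `z → ∞`; e.g. a
holomorphic homeomorphism of the plane) is of the form `f z = a z + b` with `a ≠ 0`:

* `Literature.Analysis.Complex.exists_eq_mul_add_of_differentiable_injective`.

Proof (the elementary route through the pole at infinity, no Casorati–Weierstrass and no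
polynomials). Since `f` is proper, `h z = 1 / f (1 / z)` tends to `0` at `0`, so (removable
singularity) `h` extended by `h 0 = 0` is holomorphic near `0`; it is injective near `0` because
`f` is, hence `h' 0 ≠ 0` (`Literature.Analysis.Complex.SCV.deriv_ne_zero_of_injOn`). Therefore
`z f (1/z) = z / h z → 1 / h' 0`, i.e. `f w / w` has a finite limit at infinity, so the entire
function `dslope f 0 = (f w - f 0) / w` is bounded, hence constant by Liouville's theorem
(`Differentiable.apply_eq_apply_of_bounded`): `f w = f' 0 · w + f 0`.

Corollaries for plane homeomorphisms: a holomorphic homeomorphism of `ℂ` is `z ↦ a z + b`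
(`Homeomorph.exists_eq_mul_add_of_differentiable`), an anti-holomorphic one is `z ↦ a z̄ + b`
(`Homeomorph.exists_eq_mul_conj_add_of_differentiable_conj`).

The classical theorem (Conway, *Functions of One Complex Variable I* (1978), Ch. V §1 and §3,
exercises; Remmert, *Theory of Complex Functions*, Ch. 10) has no properness hypothesis: an
injective entire function is automatically proper (its image is a simply connected domain
biholomorphic to `ℂ`, hence all of `ℂ` by the Riemann mapping theorem and Liouville). Only the
proper case is needed by its user (rigidity of SLE₆-preserving homeomorphisms,
`Summits/CriticalPhenomena/CardyFormulaZ2`) and proved here.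

Mathlib has Liouville (`Differentiable.apply_eq_apply_of_bounded`), removable singularities
(`Complex.differentiableOn_compl_singleton_and_continuousAt_iff`) and `dslope`, but no statement
about injective entire functions (searched `Injective.*entire`, `affine_of`, `polynomial_of_injective`).
-/

noncomputable section

open Filter Metric Set Bornology Function
open scoped Topology ComplexConjugate

namespace Literature.Analysis.Complex

/-- A proper map of the plane is eventually (near infinity) of norm `> 1`: there is a radius `R > 0`
with `1 < ‖f z‖` whenever `R < ‖z‖`. [folklore] -/
theorem exists_radius_one_lt_norm {f : ℂ → ℂ} (hprop : Tendsto f (cocompact ℂ) (cocompact ℂ)) :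
    ∃ R : ℝ, 0 < R ∧ ∀ z : ℂ, R < ‖z‖ → 1 < ‖f z‖ := by
  have h1 : Tendsto (fun z ↦ ‖f z‖) (cocompact ℂ) atTop :=
    tendsto_norm_cocompact_atTop.comp hprop
  have h2 : ∀ᶠ z in cobounded ℂ, 1 < ‖f z‖ := by
    rw [cobounded_eq_cocompact]
    exact h1.eventually (eventually_gt_atTop 1)
  obtain ⟨r, -, hr⟩ := (hasBasis_cobounded_compl_closedBall (0 : ℂ)).eventually_iff.1 h2
  refine ⟨max r 1, lt_max_of_lt_right one_pos, fun z hz ↦ hr ?_⟩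
  rw [mem_compl_iff, mem_closedBall_zero_iff, not_le]
  exact (le_max_left _ _).trans_lt hz

/-- **A proper injective entire function is affine.** If `f : ℂ → ℂ` is complex differentiable
everywhere, injective, and proper (`Tendsto f (cocompact ℂ) (cocompact ℂ)`), then
`f z = a z + b` for some `a ≠ 0` and `b`. (Pole at infinity: `1 / f (1/z)` has a removable
singularity and an injective extension at `0`, so its derivative there is non-zero and `f w / w`
is bounded at infinity; Liouville for `dslope f 0`.) Conway (1978), Ch. V; Remmert, *Theory of
Complex Functions*, Ch. 10 §2. [folklore] -/
theorem exists_eq_mul_add_of_differentiable_injective {f : ℂ → ℂ} (hf : Differentiable ℂ f)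
    (hinj : Injective f) (hprop : Tendsto f (cocompact ℂ) (cocompact ℂ)) :
    ∃ a b : ℂ, a ≠ 0 ∧ ∀ z, f z = a * z + b := by
  classical
  obtain ⟨R, hR, hRf⟩ := exists_radius_one_lt_norm hprop
  -- `f (1/z) ≠ 0` on the punctured disc of radius `1/R`
  have hfne : ∀ z : ℂ, z ≠ 0 → ‖z‖ < R⁻¹ → f z⁻¹ ≠ 0 := by
    intro z hz hzR h0
    have h1 : R < ‖z⁻¹‖ := by
      rw [norm_inv]
      rwa [lt_inv_comm₀ hR (norm_pos_iff.2 hz)]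
    have := hRf _ h1
    rw [h0, norm_zero] at this
    exact absurd this (by norm_num)
  -- the function `h z = 1 / f (1 / z)`, `h 0 = 0`
  set g : ℂ → ℂ := fun z ↦ (f z⁻¹)⁻¹ with hg
  set h : ℂ → ℂ := update g 0 0 with hh
  have hhg : ∀ z, z ≠ 0 → h z = (f z⁻¹)⁻¹ := fun z hz ↦ by rw [hh, update_of_ne hz]
  have hh0 : h 0 = 0 := by rw [hh, update_self]
  -- `h → 0` at `0`, so `h` is continuous at `0`
  have hlim : Tendsto g (𝓝[≠] 0) (𝓝 0) := by
    have h1 : Tendsto (fun z : ℂ ↦ z⁻¹) (𝓝[≠] 0) (cocompact ℂ) := by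
      rw [← cobounded_eq_cocompact]
      exact tendsto_inv₀_nhdsNE_zero
    have h2 : Tendsto (fun z : ℂ ↦ f z⁻¹) (𝓝[≠] 0) (cobounded ℂ) := by
      rw [cobounded_eq_cocompact]
      exact hprop.comp h1
    exact tendsto_inv₀_cobounded.comp h2
  have hcont : ContinuousAt h 0 := by
    rw [hh, continuousAt_update_same]
    exact hlim
  -- `h` is holomorphic on the disc `ball 0 (1/R)`
  have hball : ball (0 : ℂ) R⁻¹ ∈ 𝓝 (0 : ℂ) := isOpen_ball.mem_nhds (mem_ball_self (inv_pos.2 hR))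
  have hdiff : DifferentiableOn ℂ h (ball 0 R⁻¹) := by
    refine (Complex.differentiableOn_compl_singleton_and_continuousAt_iff hball).1 ⟨?_, hcont⟩
    rintro z ⟨hzR, hz0⟩
    rw [mem_ball_zero_iff] at hzR
    have hz0 : z ≠ 0 := hz0
    have hgd : DifferentiableAt ℂ g z :=
      (((hf _).comp z (differentiableAt_inv hz0))).inv (hfne z hz0 hzR)
    have heq : h =ᶠ[𝓝 z] g := by
      filter_upwards [isOpen_ne.mem_nhds hz0] with w hw
      rw [hh, update_of_ne hw]
    exact (hgd.congr_of_eventuallyEq heq).differentiableWithinAt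
  -- `h` is injective on that disc
  have hinjh : InjOn h (ball 0 R⁻¹) := by
    intro z hz z' hz' hzz'
    rw [mem_ball_zero_iff] at hz hz'
    by_cases h0 : z = 0
    · by_cases h0' : z' = 0
      · rw [h0, h0']
      · exfalso
        rw [h0, hh0, hhg z' h0', eq_comm, inv_eq_zero] at hzz'
        exact hfne z' h0' hz' hzz'
    · by_cases h0' : z' = 0
      · exfalso
        rw [h0', hh0, hhg z h0, inv_eq_zero] at hzz'
        exact hfne z h0 hz hzz'
      · rw [hhg z h0, hhg z' h0', inv_inj] at hzz'
        exact inv_injective (hinj hzz')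
  -- hence `h' 0 ≠ 0`
  have hder : deriv h 0 ≠ 0 :=
    SCV.deriv_ne_zero_of_injOn hdiff isOpen_ball hinjh (mem_ball_self (inv_pos.2 hR))
  set c : ℂ := deriv h 0 with hc
  have hhd : HasDerivAt h c 0 := (hdiff.differentiableAt hball).hasDerivAt
  -- `z * f (1/z) → 1/c` as `z → 0`
  have hslope : Tendsto (fun t : ℂ ↦ t⁻¹ * h t) (𝓝[≠] 0) (𝓝 c) := by
    have := hasDerivAt_iff_tendsto_slope_zero.1 hhd
    simpa only [zero_add, hh0, sub_zero, smul_eq_mul] using this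
  have hzf : Tendsto (fun t : ℂ ↦ t * f t⁻¹) (𝓝[≠] 0) (𝓝 c⁻¹) := by
    refine (hslope.inv₀ hder).congr' ?_
    filter_upwards [self_mem_nhdsWithin] with t ht
    rw [hhg t ht, ← mul_inv, inv_inv]
  -- `f w / w → 1/c` as `w → ∞`
  have hfw : Tendsto (fun w : ℂ ↦ w⁻¹ * f w) (cocompact ℂ) (𝓝 c⁻¹) := by
    have h1 : Tendsto (fun w : ℂ ↦ w⁻¹) (cocompact ℂ) (𝓝[≠] 0) := by
      rw [← cobounded_eq_cocompact]
      exact tendsto_inv₀_cobounded'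
    have := hzf.comp h1
    simpa only [Function.comp_def, inv_inv] using this
  -- the entire function `F = dslope f 0` is bounded
  set F : ℂ → ℂ := dslope f 0 with hF
  have hFd : Differentiable ℂ F := by
    rw [← differentiableOn_univ, hF, Complex.differentiableOn_dslope univ_mem]
    exact hf.differentiableOn
  have hFlim : Tendsto F (cocompact ℂ) (𝓝 (c⁻¹ - 0 * f 0)) := by
    have h0 : Tendsto (fun w : ℂ ↦ w⁻¹ * f 0) (cocompact ℂ) (𝓝 (0 * f 0)) := by
      refine Tendsto.mul_const _ ?_
      rw [← cobounded_eq_cocompact]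
      exact tendsto_inv₀_cobounded
    refine (hfw.sub h0).congr' ?_
    have hne : ∀ᶠ w in cocompact ℂ, w ≠ 0 := by
      rw [← cobounded_eq_cocompact]
      exact eventually_ne_cobounded 0
    filter_upwards [hne] with w hw
    rw [hF, dslope_of_ne _ hw, slope_def_field, sub_zero]
    field_simp
  have hFb : IsBounded (range F) := by
    -- bounded near infinity by the limit, on a compact ball by continuity
    have h1 : ∀ᶠ w in cocompact ℂ, ‖F w‖ < ‖c⁻¹ - 0 * f 0‖ + 1 :=
      (hFlim.norm).eventually (eventually_lt_nhds (lt_add_one _))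
    rw [← cobounded_eq_cocompact] at h1
    obtain ⟨r, -, hr⟩ := (hasBasis_cobounded_compl_closedBall (0 : ℂ)).eventually_iff.1 h1
    obtain ⟨M, hM⟩ := (isCompact_closedBall (0 : ℂ) r).exists_bound_of_continuousOn
      hFd.continuous.continuousOn
    refine isBounded_iff_forall_norm_le.2 ⟨max M (‖c⁻¹ - 0 * f 0‖ + 1), ?_⟩
    rintro _ ⟨w, rfl⟩
    by_cases hw : w ∈ closedBall (0 : ℂ) r
    · exact (hM w hw).trans (le_max_left _ _)
    · exact (hr hw).le.trans (le_max_right _ _)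
  -- Liouville
  have hconst : ∀ w, F w = F 0 := fun w ↦ hFd.apply_eq_apply_of_bounded hFb w 0
  have hF0 : F 0 = deriv f 0 := by rw [hF, dslope_same]
  refine ⟨deriv f 0, f 0, ?_, fun w ↦ ?_⟩
  · intro h0
    have h10 : f 1 = f 0 := by
      have := hconst 1
      rw [hF0, h0, hF, dslope_of_ne _ one_ne_zero, slope_def_field, sub_zero, div_one,
        sub_eq_zero] at this
      exact this
    exact one_ne_zero (hinj h10)
  · by_cases hw : w = 0
    · rw [hw, mul_zero, zero_add]
    · have := hconst w
      rw [hF0, hF, dslope_of_ne _ hw, slope_def_field, sub_zero, div_eq_iff hw] at this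
      linear_combination this

/-- **A holomorphic homeomorphism of the plane is an affine map** `z ↦ a z + b`, `a ≠ 0`
(a homeomorphism is proper: `Homeomorph.map_cocompact`). Deliberate dot-notation extension of
Mathlib's `Homeomorph` namespace. Conway (1978), Ch. V. [folklore] -/
theorem _root_.Homeomorph.exists_eq_mul_add_of_differentiable (T : ℂ ≃ₜ ℂ)
    (hT : Differentiable ℂ T) : ∃ a b : ℂ, a ≠ 0 ∧ ∀ z, T z = a * z + b :=
  exists_eq_mul_add_of_differentiable_injective hT T.injective T.map_cocompact.le

/-- **An anti-holomorphic homeomorphism of the plane is** `z ↦ a z̄ + b`, `a ≠ 0` (apply the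
holomorphic case to `conj ∘ T`). Deliberate dot-notation extension of Mathlib's `Homeomorph`
namespace. Conway (1978), Ch. V. [folklore] -/
theorem _root_.Homeomorph.exists_eq_mul_conj_add_of_differentiable_conj (T : ℂ ≃ₜ ℂ)
    (hT : Differentiable ℂ (fun z ↦ conj (T z))) :
    ∃ a b : ℂ, a ≠ 0 ∧ ∀ z, T z = a * conj z + b := by
  set S : ℂ ≃ₜ ℂ := T.trans Complex.conjLIE.toHomeomorph with hS
  have hS' : Differentiable ℂ S := hT
  obtain ⟨a, b, ha, hab⟩ := S.exists_eq_mul_add_of_differentiable hS'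
  refine ⟨conj a, conj b, (map_ne_zero _).2 ha, fun z ↦ ?_⟩
  have h1 : conj (T (conj z)) = a * conj z + b := hab (conj z)
  have h2 := congrArg conj h1
  rw [Complex.conj_conj, map_add, map_mul, Complex.conj_conj] at h2
  -- `h2 : T (conj z) = conj a * z + conj b`; substitute `z ↦ conj z`
  have h3 := hab z
  have h4 := congrArg conj h3
  rw [map_add, map_mul] at h4
  change conj (conj (T z)) = _ at h4
  rwa [Complex.conj_conj] at h4

end Literature.Analysis.Complex
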